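import Literature.NumberTheory.EllipticCurves.BinaryQuarticIntegralAction
import Literature.NumberTheory.EllipticCurves.BinaryQuarticOrbitChart
import Literature.NumberTheory.EllipticCurves.BinaryQuarticPadicMinimisationProofs
import Literature.GroupTheory.Index.PadicGL2Congruence
import Literature.RingTheory.HenselLemma.PadicSystems
import HarnessLib

/-!
# Orbit tubes in `V_{ℤ_p}`: congruence subgroups, slices, the orbit chart's image, stabilisers
# (the structure behind Bhargava–Shankar's `p`-adic change of measure, Props. 3.11–3.12)

Topic `Literature/NumberTheory/EllipticCurves`; continues `BinaryQuarticIntegralAction.lean`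
(the twisted action of `GL₂(ℤ_p)` on `V_{ℤ_p}`), `BinaryQuarticOrbitChart.lean` (the polynomial
systems `Ψ = orbitChart`, `Φ = invChart`, `27 det J_Ψ = det J_Φ = m(f,w)`) and
`Literature/RingTheory/HenselLemma/PadicSystems.lean` (the exact image of a small ball under an
étale polynomial map). Definitions and theorems; no named facts.

For `f₁ ∈ V_{ℤ_p}` with `Δ(f₁) ≠ 0` and a transverse coordinate direction `w` (`m(f₁, w) ≠ 0`), and
`r` with `p⁻ʳ < |m(f₁,w)|_p`, we set up the **orbit tube** through `f₁`:

* with `K_r = GL2.congruenceSubgroup r`, `ℤ_pˣ·1 = GL2.scalarSubgroup`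
  (`Literature/GroupTheory/Index/PadicGL2Congruence.lean`):
  `autCard f = [Stab_{GL₂(ℤ_p)}(f) : ℤ_pˣ]` (`#Aut_{ℤ_p}(f)`);
* `slice f₁ w r = S_r = {(1+u) f₁ + v w : |u|, |v| ≤ p⁻ʳ}`, `chartBox r` (the ball of radius `p⁻ʳ`
  about the base point of the charts), `chartImage f₁ w r = W_r = Ψ(chartBox r)` (as forms),
  `tube f₁ w r = U_r = GL₂(ℤ_p) · S_r`, `invPair f = (I(f), J(f))`,
  `invBox f₁ w r = B = (I(f₁), J(f₁)) + (2I ∂I(w); 3J ∂J(w)) · (pʳℤ_p)²`;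

and prove the structural facts used by the volume computation (companion `Proofs` files):

* `invPair_injOn_slice` — `(I, J)` is injective on the slice, and `invPair_image_slice`:
  **`(I,J)(S_r) = B`** (Hensel for `Φ`);
* `chartImage_eq` — **`W_r = K_r · S_r`** (a reparametrisation of the chart: the matrices
  `(1 β; γ δ+βγ)`, `β, γ, δ−1 ∈ pʳℤ_p`, times the scalars `1 + pʳℤ_p`, fill `K_r`, scalars acting
  trivially);
* `setOf_smul_mem_chartImage` — for `s ∈ S_r`, **`{h : h · s ∈ W_r} = K_r · Stab(s)`**;
* `stabilizer_inf_congruenceSubgroup` — for `Δ(s) ≠ 0` and `pʳ ∤ 2`,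
  **`Stab(s) ∩ K_r = ℤ_pˣ ∩ K_r`** (a non-scalar stabilising matrix has trace `0`,
  `trace_eq_zero_of_mem_stabilizerSet`, but is `≡ 1 (mod pʳ)`);
* `mem_orbit_of_invPair_eq` — two points of the tube with the same invariants lie in one
  `GL₂(ℤ_p)`-orbit: **the fibres of `(I, J)` in `U_r` are single orbits**.

## References

* M. Bhargava, A. Shankar, Ann. of Math. (2) 181 (2015) 191–242, Props. 3.11–3.12 and Cor. 3.8 of
  the published version (Prop. 2.7 and proof of Prop. 5.12 of arXiv:1006.1002v2: "`B_p^F := ⋃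
  PGL₂(ℤ_p) · f` … can be computed using a Jacobian change of variables").
  [cite: BhargavaShankarAnnals2015, Prop. 5.12 proof (arXiv:1006.1002v2 numbering)]
-/

noncomputable section

open scoped Classical Pointwise
open Matrix MulAction Set Metric MvPolynomial Literature.GroupTheory.Index

namespace Literature.NumberTheory.EllipticCurves

namespace BinaryQuartic

open scoped IntegralAction

variable {p : ℕ} [Fact p.Prime]

local notation "G" => GL (Fin 2) ℤ_[p]

/-! ## Congruence subgroups, scalars, `#Aut_{ℤ_p}` -/

/-- Scalars act trivially: `ℤ_pˣ · 1 ≤ Stab(f)`. [folklore] -/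
theorem scalarSubgroup_le_stabilizer (f : BinaryQuartic ℤ_[p]) : GL2.scalarSubgroup ≤ stabilizer G f := by
  rintro _ ⟨c, rfl⟩
  exact scalarGL_smul c f

/-- **`#Aut_{ℤ_p}(f) = [Stab_{GL₂(ℤ_p)}(f) : ℤ_pˣ]`**, the order of the stabiliser of `f` in
`PGL₂(ℤ_p)` (Bhargava–Shankar's `#Aut_{ℤ_p}(f)`; `0` if infinite). [cite: BhargavaShankarAnnals2015, §3.2 (Aut_{ℤ_p}(f); published numbering)] -/
def autCard (f : BinaryQuartic ℤ_[p]) : ℕ := GL2.scalarSubgroup.relIndex (stabilizer G f)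

/-! ## The invariant pair, the slice, the tube -/

/-- The pair of invariants `(I(f), J(f)) ∈ ℤ_p²`. [folklore] -/
def invPair (f : BinaryQuartic ℤ_[p]) : ℤ_[p] × ℤ_[p] := (f.I, f.J)

/-- `invPair` is continuous. [folklore] -/
theorem continuous_invPair : Continuous (invPair : BinaryQuartic ℤ_[p] → ℤ_[p] × ℤ_[p]) := by
  have hI : Continuous fun f : BinaryQuartic ℤ_[p] ↦ f.I := by simp only [I]; fun_prop
  have hJ : Continuous fun f : BinaryQuartic ℤ_[p] ↦ f.J := by simp only [J]; fun_prop
  exact hI.prodMk hJ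

/-- `invPair` is invariant: `(I, J)(g • f) = (I, J)(f)`. [folklore] -/
theorem invPair_glInt_smul (g : G) (f : BinaryQuartic ℤ_[p]) : invPair (g • f) = invPair f := by
  simp only [invPair, I_glInt_smul, J_glInt_smul]

/-- **The slice** `S_r = {(1+u) f₁ + v w : |u|, |v| ≤ p⁻ʳ}` through `f₁` in the directions `f₁`
(scaling) and `w`. [folklore] -/
def slice (f₁ w : BinaryQuartic ℤ_[p]) (r : ℕ) : Set (BinaryQuartic ℤ_[p]) :=
  {s | ∃ u v : ℤ_[p], ‖u‖ ≤ (p : ℝ) ^ (-(r : ℤ)) ∧ ‖v‖ ≤ (p : ℝ) ^ (-(r : ℤ)) ∧ s = (1 + u) • f₁ + v • w}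

/-- `f₁` lies on its slice (`u = v = 0`). [folklore] -/
theorem self_mem_slice (f₁ w : BinaryQuartic ℤ_[p]) (r : ℕ) : f₁ ∈ slice f₁ w r :=
  ⟨0, 0, by simp, by simp, by simp⟩

/-- **The orbit tube** `U_r = GL₂(ℤ_p) · S_r`. [folklore] -/
def tube (f₁ w : BinaryQuartic ℤ_[p]) (r : ℕ) : Set (BinaryQuartic ℤ_[p]) :=
  {f | ∃ g : G, ∃ s ∈ slice f₁ w r, f = g • s}

/-- The tube is invariant. [folklore] -/
theorem smul_mem_tube_iff (g : G) {f₁ w f : BinaryQuartic ℤ_[p]} {r : ℕ} :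
    g • f ∈ tube f₁ w r ↔ f ∈ tube f₁ w r := by
  constructor
  · rintro ⟨g', s, hs, h⟩
    exact ⟨g⁻¹ * g', s, hs, by rw [mul_smul, ← h, inv_smul_smul]⟩
  · rintro ⟨g', s, hs, rfl⟩
    exact ⟨g * g', s, hs, by rw [mul_smul]⟩

/-- The slice lies in the tube. [folklore] -/
theorem slice_subset_tube (f₁ w : BinaryQuartic ℤ_[p]) (r : ℕ) : slice f₁ w r ⊆ tube f₁ w r :=
  fun s hs ↦ ⟨1, s, hs, (one_smul _ _).symm⟩

/-! ## The chart box and the images of the two charts -/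

/-- The ball of radius `p⁻ʳ` about the base point `(0,0,1,0,0)` of the charts. [folklore] -/
def chartBox (r : ℕ) : Set (Fin 5 → ℤ_[p]) := closedBall chartCenter ((p : ℝ) ^ (-(r : ℤ)))

/-- Membership in the chart box, coordinatewise. [folklore] -/
theorem mem_chartBox_iff {r : ℕ} {x : Fin 5 → ℤ_[p]} :
    x ∈ chartBox r ↔ ‖x 0‖ ≤ (p : ℝ) ^ (-(r : ℤ)) ∧ ‖x 1‖ ≤ (p : ℝ) ^ (-(r : ℤ)) ∧
      ‖x 2 - 1‖ ≤ (p : ℝ) ^ (-(r : ℤ)) ∧ ‖x 3‖ ≤ (p : ℝ) ^ (-(r : ℤ)) ∧ ‖x 4‖ ≤ (p : ℝ) ^ (-(r : ℤ)) := by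
  rw [chartBox, mem_closedBall, dist_eq_norm, pi_norm_le_iff_of_nonneg (by positivity)]
  simp only [Fin.forall_fin_succ, Pi.sub_apply, chartCenter]
  simp

/-- The orbit chart as a map into forms. [folklore] -/
def orbitChartForm (f₁ w : BinaryQuartic ℤ_[p]) (x : Fin 5 → ℤ_[p]) : BinaryQuartic ℤ_[p] :=
  equivFin5.symm fun i ↦ MvPolynomial.eval x (orbitChart f₁ w i)

/-- Its value: `((1 + x₃) f₁ + x₄ w)((x,y)·M(x))`, `M(x) = (1 x₀; x₁ x₂+x₀x₁)`. [folklore] -/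
theorem orbitChartForm_eq (f₁ w : BinaryQuartic ℤ_[p]) (x : Fin 5 → ℤ_[p]) :
    orbitChartForm f₁ w x = ((1 + x 3) • f₁ + x 4 • w).subst !![1, x 0; x 1, x 2 + x 0 * x 1] := by
  apply equivFin5.injective
  rw [orbitChartForm, Equiv.apply_symm_apply, eval_orbitChart]
  rfl

/-- `coeffs ∘ orbitChartForm = Ψ`. [folklore] -/
theorem coeffs_orbitChartForm (f₁ w : BinaryQuartic ℤ_[p]) (x : Fin 5 → ℤ_[p]) :
    (orbitChartForm f₁ w x).coeffs = fun i ↦ MvPolynomial.eval x (orbitChart f₁ w i) :=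
  equivFin5.apply_symm_apply _

/-- **The chart image** `W_r = Ψ(chartBox r)`, as a set of forms. [folklore] -/
def chartImage (f₁ w : BinaryQuartic ℤ_[p]) (r : ℕ) : Set (BinaryQuartic ℤ_[p]) :=
  orbitChartForm f₁ w '' chartBox r

/-- **The invariant box** `B = (I(f₁), J(f₁)) + (2I ∂I(w); 3J ∂J(w)) · (pʳℤ_p)²`. [folklore] -/
def invBox (f₁ w : BinaryQuartic ℤ_[p]) (r : ℕ) : Set (ℤ_[p] × ℤ_[p]) :=
  {IJ | ∃ z : Fin 2 → ℤ_[p], ‖z‖ ≤ (p : ℝ) ^ (-(r : ℤ)) ∧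
    IJ = (f₁.I + (invBlock f₁ w *ᵥ z) 0, f₁.J + (invBlock f₁ w *ᵥ z) 1)}

/-! ## The invariant chart on the box: injectivity, the slice, the invariant box -/

/-- The Jacobian condition for `Φ`: `det J_Φ(x₀) = m(f₁, w)`. [folklore] -/
theorem det_jacobian_invChart (f₁ w : BinaryQuartic ℤ_[p]) :
    (Matrix.of fun i j ↦ MvPolynomial.eval chartCenter (pderiv j (invChart f₁ w i))).det = f₁.sliceJac w := by
  rw [jacobian_invChart, det_jacInv]

/-- The point of the box attached to slice parameters `(u, v)`: `(0, 0, 1, u, v)`. [folklore] -/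
def slicePoint (u v : ℤ_[p]) : Fin 5 → ℤ_[p] := ![0, 0, 1, u, v]

/-- `(0,0,1,u,v)` lies in the chart box iff `|u|, |v| ≤ p⁻ʳ`. [folklore] -/
theorem slicePoint_mem_chartBox_iff {r : ℕ} {u v : ℤ_[p]} :
    slicePoint u v ∈ chartBox r ↔ ‖u‖ ≤ (p : ℝ) ^ (-(r : ℤ)) ∧ ‖v‖ ≤ (p : ℝ) ^ (-(r : ℤ)) := by
  rw [mem_chartBox_iff]
  simp [slicePoint]

/-- `Φ(0,0,1,u,v) = (0, 0, 1, I(s), J(s))` for the slice form `s = (1+u) f₁ + v w`. [folklore] -/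
theorem eval_invChart_slicePoint (f₁ w : BinaryQuartic ℤ_[p]) (u v : ℤ_[p]) :
    (fun i ↦ MvPolynomial.eval (slicePoint u v) (invChart f₁ w i)) =
      ![0, 0, 1, ((1 + u) • f₁ + v • w).I, ((1 + u) • f₁ + v • w).J] := by
  rw [eval_invChart]
  simp [slicePoint]

/-- **`(I, J)` is injective on the slice** when `p⁻ʳ < |m(f₁,w)|_p` (Hensel: `Φ` is injective on
the box, and `Φ(0,0,1,u,v) = (0,0,1,I(s),J(s))`). [folklore] -/
theorem invPair_injOn_slice (f₁ w : BinaryQuartic ℤ_[p]) {r : ℕ}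
    (hr : (p : ℝ) ^ (-(r : ℤ)) < ‖f₁.sliceJac w‖) : InjOn invPair (slice f₁ w r) := by
  have hm : f₁.sliceJac w ≠ 0 := by
    intro h0; rw [h0, norm_zero] at hr; exact (lt_irrefl _ (hr.trans_le' (by positivity))).elim
  have hd : (Matrix.of fun i j ↦ MvPolynomial.eval chartCenter (pderiv j (invChart f₁ w i))).det ≠ 0 := by
    rw [det_jacobian_invChart]; exact hm
  have hrd : (p : ℝ) ^ (-(r : ℤ)) < ‖(Matrix.of fun i j ↦ MvPolynomial.eval chartCenter (pderiv j (invChart f₁ w i))).det‖ := by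
    rw [det_jacobian_invChart]; exact hr
  have hinj := Literature.RingTheory.HenselLemma.injOn_eval_closedBall (invChart f₁ w) chartCenter hd
    (by positivity) hrd
  rintro s ⟨u, v, hu, hv, rfl⟩ s' ⟨u', v', hu', hv', rfl⟩ heq
  simp only [invPair, Prod.mk.injEq] at heq
  have key : slicePoint u v = slicePoint u' v' := by
    refine hinj (slicePoint_mem_chartBox_iff.mpr ⟨hu, hv⟩) (slicePoint_mem_chartBox_iff.mpr ⟨hu', hv'⟩) ?_
    beta_reduce
    rw [eval_invChart_slicePoint, eval_invChart_slicePoint, heq.1, heq.2]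
  have hu_eq : u = u' := by simpa [slicePoint] using congrFun key 3
  have hv_eq : v = v' := by simpa [slicePoint] using congrFun key 4
  rw [hu_eq, hv_eq]

/-- The linearised image of the box under `Φ`: `Φ(x₀) + J_Φ · B_r`. Points with group coordinates
`(0, 0, 1)` are exactly `(0, 0, 1) × B`, `B` the invariant box (the shear `J_Φ = J'_Φ · S`).
[folklore] -/
theorem mem_image_jacInv_iff (f₁ w : BinaryQuartic ℤ_[p]) (r : ℕ) (IJ : ℤ_[p] × ℤ_[p]) :
    (![0, 0, 1, IJ.1, IJ.2] : Fin 5 → ℤ_[p]) ∈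
        (fun z ↦ (fun i ↦ MvPolynomial.eval chartCenter (invChart f₁ w i)) + jacInv f₁ w *ᵥ z) ''
          closedBall (0 : Fin 5 → ℤ_[p]) ((p : ℝ) ^ (-(r : ℤ))) ↔
      IJ ∈ invBox f₁ w r := by
  rw [eval_invChart_center]
  constructor
  · rintro ⟨z, hz, hzeq⟩
    rw [mem_closedBall, dist_zero_right, pi_norm_le_iff_of_nonneg (by positivity)] at hz
    beta_reduce at hzeq
    rw [jacInv_eq_mul_shear, ← Matrix.mulVec_mulVec, shear_mulVec, jacInv'_mulVec] at hzeq
    have h0 := congrFun hzeq 0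
    have h1 := congrFun hzeq 1
    have h2 := congrFun hzeq 2
    have h3 := congrFun hzeq 3
    have h4 := congrFun hzeq 4
    simp at h0 h1 h2 h3 h4
    -- `z₂ = 0`, so the invariant coordinates are `(I₁, J₁) + invBlock (z₃, z₄)`
    refine ⟨![z 3, z 4], ?_, ?_⟩
    · rw [pi_norm_le_iff_of_nonneg (by positivity)]
      intro i
      fin_cases i
      · simpa using hz 3
      · simpa using hz 4
    · ext
      · simp only [invBlock, Matrix.mulVec, dotProduct, Fin.sum_univ_two]
        simp [← h3, h2]
      · simp only [invBlock, Matrix.mulVec, dotProduct, Fin.sum_univ_two]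
        simp [← h4, h2]
  · rintro ⟨z, hz, hIJ⟩
    have hp0 : (0 : ℝ) ≤ (p : ℝ) ^ (-(r : ℤ)) := by positivity
    rw [pi_norm_le_iff_of_nonneg hp0] at hz
    refine ⟨![0, 0, 0, z 0, z 1], ?_, ?_⟩
    · rw [mem_closedBall, dist_zero_right, pi_norm_le_iff_of_nonneg hp0]
      intro i
      fin_cases i
      · simp
      · simp
      · simp
      · simpa using hz 0
      · simpa using hz 1
    · beta_reduce
      rw [jacInv_eq_mul_shear, ← Matrix.mulVec_mulVec, shear_mulVec, jacInv'_mulVec, hIJ]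
      funext i
      fin_cases i <;> simp [invBlock, Matrix.mulVec, dotProduct, Fin.sum_univ_two]

/-- **`(I, J)(S_r) = B`**: the invariants of the slice fill exactly the invariant box (Hensel's
lemma for `Φ`: `Φ(chartBox r) = Φ(x₀) + J_Φ · B_r`, restricted to group coordinates `(0,0,1)`).
[folklore] -/
theorem invPair_image_slice (f₁ w : BinaryQuartic ℤ_[p]) {r : ℕ}
    (hr : (p : ℝ) ^ (-(r : ℤ)) < ‖f₁.sliceJac w‖) : invPair '' slice f₁ w r = invBox f₁ w r := by
  have hm : f₁.sliceJac w ≠ 0 := by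
    intro h0; rw [h0, norm_zero] at hr; exact (lt_irrefl _ (hr.trans_le' (by positivity))).elim
  have hd : (Matrix.of fun i j ↦ MvPolynomial.eval chartCenter (pderiv j (invChart f₁ w i))).det ≠ 0 := by
    rw [det_jacobian_invChart]; exact hm
  have hrd : (p : ℝ) ^ (-(r : ℤ)) < ‖(Matrix.of fun i j ↦ MvPolynomial.eval chartCenter (pderiv j (invChart f₁ w i))).det‖ := by
    rw [det_jacobian_invChart]; exact hr
  have himg := Literature.RingTheory.HenselLemma.image_eval_closedBall_eq (invChart f₁ w) chartCenter hd
    (by positivity) hrd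
  rw [jacobian_invChart] at himg
  ext IJ
  rw [← mem_image_jacInv_iff, ← himg]
  constructor
  · rintro ⟨s, ⟨u, v, hu, hv, rfl⟩, rfl⟩
    refine ⟨slicePoint u v, slicePoint_mem_chartBox_iff.mpr ⟨hu, hv⟩, ?_⟩
    beta_reduce
    rw [eval_invChart_slicePoint]; rfl
  · rintro ⟨x, hx, hxeq⟩
    beta_reduce at hxeq
    rw [eval_invChart] at hxeq
    have h0 := congrFun hxeq 0
    have h1 := congrFun hxeq 1
    have h2 := congrFun hxeq 2
    have h3 := congrFun hxeq 3
    have h4 := congrFun hxeq 4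
    simp at h0 h1 h2 h3 h4
    have hx' : x ∈ chartBox r := hx
    rw [mem_chartBox_iff] at hx'
    refine ⟨(1 + x 3) • f₁ + x 4 • w, ⟨x 3, x 4, hx'.2.2.2.1, hx'.2.2.2.2, rfl⟩, ?_⟩
    rw [h2] at h3 h4
    simp at h3 h4
    exact Prod.ext h3 h4

/-! ## Stabilisers meet the congruence subgroup only in scalars -/

/-- The image of `GL₂(ℤ_p)` in `GL₂(ℚ_p)` is injective on matrices. [folklore] -/
theorem map_coe_injective_matrix {g g' : Matrix (Fin 2) (Fin 2) ℤ_[p]}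
    (h : g.map PadicInt.Coe.ringHom = g'.map PadicInt.Coe.ringHom) : g = g' := by
  ext i j
  have := congrFun (congrFun h i) j
  simp only [Matrix.map_apply] at this
  exact Subtype.coe_injective this

/-- An element of `Stab(f)` gives an element of the stabiliser set of `f ⊗ ℚ_p`. [folklore] -/
theorem map_mem_stabilizerSet_of_mem_stabilizer {f : BinaryQuartic ℤ_[p]} {g : G} (hg : g ∈ stabilizer G f) :
    (g : Matrix (Fin 2) (Fin 2) ℤ_[p]).map PadicInt.Coe.ringHom ∈ stabilizerSet (f.map PadicInt.Coe.ringHom) := by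
  refine ⟨?_, ?_⟩
  · rw [← RingHom.mapMatrix_apply, ← RingHom.map_det]
    change ((g : Matrix (Fin 2) (Fin 2) ℤ_[p]).det : ℚ_[p]) ≠ 0
    rw [PadicInt.coe_ne_zero, ← Matrix.GeneralLinearGroup.val_det_apply]
    exact Units.ne_zero _
  · rw [← map_glInt_smul, mem_stabilizer_iff.mp hg]

/-- **`Stab(s) ∩ K_r = ℤ_pˣ ∩ K_r`** for `Δ(s) ≠ 0` and `pʳ ∤ 2`: a stabilising `g ≡ 1 (mod pʳ)` is
scalar, for otherwise its trace vanishes (`trace_eq_zero_of_mem_stabilizerSet`) while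
`tr g ≡ 2 (mod pʳ)`. [folklore] -/
theorem stabilizer_inf_congruenceSubgroup {s : BinaryQuartic ℤ_[p]} (hΔ : s.disc ≠ 0) {r : ℕ}
    (h2 : ¬ (p : ℤ_[p]) ^ r ∣ 2) :
    stabilizer G s ⊓ GL2.congruenceSubgroup r = GL2.scalarSubgroup ⊓ GL2.congruenceSubgroup r := by
  refine le_antisymm ?_ (inf_le_inf_right _ (scalarSubgroup_le_stabilizer s))
  intro g hg
  obtain ⟨hgs, hgK⟩ := Subgroup.mem_inf.mp hg
  refine Subgroup.mem_inf.mpr ⟨?_, hgK⟩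
  rw [GL2.mem_congruenceSubgroup_iff] at hgK
  -- is `g` scalar over `ℚ_p`?
  by_cases hsc : ∃ c : ℚ_[p], (g : Matrix (Fin 2) (Fin 2) ℤ_[p]).map PadicInt.Coe.ringHom = c • (1 : Matrix (Fin 2) (Fin 2) ℚ_[p])
  · obtain ⟨c, hc⟩ := hsc
    have h00 := congrFun (congrFun hc 0) 0
    have h01 := congrFun (congrFun hc 0) 1
    have h10 := congrFun (congrFun hc 1) 0
    have h11 := congrFun (congrFun hc 1) 1
    simp [Matrix.map_apply] at h00 h01 h10 h11
    -- `c = g₀₀ ∈ ℤ_p`, a unit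
    have hunit : IsUnit ((g : Matrix (Fin 2) (Fin 2) ℤ_[p]) 0 0 * (g : Matrix (Fin 2) (Fin 2) ℤ_[p]) 1 1) := by
      have hdet : IsUnit (g : Matrix (Fin 2) (Fin 2) ℤ_[p]).det := by
        rw [← Matrix.GeneralLinearGroup.val_det_apply]; exact Units.isUnit _
      rw [Matrix.det_fin_two] at hdet
      have h01' : (g : Matrix (Fin 2) (Fin 2) ℤ_[p]) 0 1 = 0 := by exact_mod_cast h01
      rwa [h01', zero_mul, sub_zero] at hdet
    obtain ⟨c₀, hc₀⟩ := (isUnit_of_mul_isUnit_left hunit)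
    rw [GL2.mem_scalarSubgroup_iff]
    refine ⟨c₀, ?_⟩
    apply map_coe_injective_matrix
    rw [hc]
    have hcc : c = ((c₀ : ℤ_[p]) : ℚ_[p]) := by rw [hc₀]; exact h00.symm
    rw [hcc]
    ext i j
    fin_cases i <;> fin_cases j <;> simp [Matrix.map_apply]
  · -- non-scalar: trace zero, contradiction with `g ≡ 1 (mod pʳ)`
    exfalso
    have hΔ' : (s.map PadicInt.Coe.ringHom).disc ≠ 0 := by
      rw [disc_map]; exact PadicInt.coe_ne_zero.mpr hΔ
    have htr := trace_eq_zero_of_mem_stabilizerSet (K := ℚ_[p]) (by norm_num) (by norm_num) hΔ'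
      (map_mem_stabilizerSet_of_mem_stabilizer hgs) hsc
    simp only [Matrix.map_apply] at htr
    have htr' : (g : Matrix (Fin 2) (Fin 2) ℤ_[p]) 0 0 + (g : Matrix (Fin 2) (Fin 2) ℤ_[p]) 1 1 = 0 := by
      rw [← map_add] at htr
      exact PadicInt.coe_eq_zero.mp htr
    apply h2
    have h00 := hgK 0 0
    have h11 := hgK 1 1
    simp only [Matrix.one_apply_eq] at h00 h11
    have : (2 : ℤ_[p]) = -(((g : Matrix (Fin 2) (Fin 2) ℤ_[p]) 0 0 - 1) + ((g : Matrix (Fin 2) (Fin 2) ℤ_[p]) 1 1 - 1)) := by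
      linear_combination htr'
    rw [this, dvd_neg]
    exact dvd_add h00 h11

/-! ## Fibres of `(I, J)` in the tube are single orbits -/

/-- **Two points of the tube with the same invariants lie in one orbit.** [folklore] -/
theorem mem_orbit_of_invPair_eq (f₁ w : BinaryQuartic ℤ_[p]) {r : ℕ}
    (hr : (p : ℝ) ^ (-(r : ℤ)) < ‖f₁.sliceJac w‖) {f f' : BinaryQuartic ℤ_[p]}
    (hf : f ∈ tube f₁ w r) (hf' : f' ∈ tube f₁ w r) (h : invPair f = invPair f') :
    f' ∈ orbit G f := by
  obtain ⟨g, s, hs, rfl⟩ := hf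
  obtain ⟨g', s', hs', rfl⟩ := hf'
  rw [invPair_glInt_smul, invPair_glInt_smul] at h
  have hss' : s = s' := invPair_injOn_slice f₁ w hr hs hs' h
  subst hss'
  exact ⟨g' * g⁻¹, by simp [mul_smul]⟩

/-- Every orbit meeting the tube meets the slice in a point with the prescribed invariants: for
`f ∈ U_r` there is `s ∈ S_r` in the orbit of `f`, and `(I,J)(f) ∈ B`. [folklore] -/
theorem exists_mem_slice_of_mem_tube {f₁ w f : BinaryQuartic ℤ_[p]} {r : ℕ} (hf : f ∈ tube f₁ w r) :
    ∃ s ∈ slice f₁ w r, ∃ g : G, f = g • s ∧ invPair f = invPair s := by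
  obtain ⟨g, s, hs, rfl⟩ := hf
  exact ⟨s, hs, g, rfl, invPair_glInt_smul g s⟩

/-- `(I, J)(U_r) = B`. [folklore] -/
theorem invPair_image_tube (f₁ w : BinaryQuartic ℤ_[p]) {r : ℕ}
    (hr : (p : ℝ) ^ (-(r : ℤ)) < ‖f₁.sliceJac w‖) : invPair '' tube f₁ w r = invBox f₁ w r := by
  rw [← invPair_image_slice f₁ w hr]
  apply le_antisymm
  · rintro _ ⟨f, hf, rfl⟩
    obtain ⟨s, hs, g, rfl, h⟩ := exists_mem_slice_of_mem_tube hf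
    exact ⟨s, hs, h.symm⟩
  · exact image_mono (slice_subset_tube f₁ w r)


/-! ## `W_r = K_r · S_r`: reparametrising the chart -/

omit [Fact p.Prime] in
/-- `p⁻ʳ = (pʳ)⁻¹` in `ℝ`. [folklore] -/
theorem zpow_neg_natCast_eq (r : ℕ) : (p : ℝ) ^ (-(r : ℤ)) = ((p : ℝ) ^ r)⁻¹ := by
  rw [_root_.zpow_neg, zpow_natCast]

/-- Divisibility by `pʳ` as the norm bound `|x| ≤ p⁻ʳ`. [folklore] -/
theorem pow_dvd_iff_norm_le_zpow (x : ℤ_[p]) (r : ℕ) : (p : ℤ_[p]) ^ r ∣ x ↔ ‖x‖ ≤ (p : ℝ) ^ (-(r : ℤ)) := by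
  rw [zpow_neg_natCast_eq]; exact padicInt_pow_dvd_iff_norm_le x r

/-- An element `≡ 1 (mod pʳ)`, `r ≥ 1`, is a unit. [folklore] -/
theorem isUnit_of_pow_dvd_sub_one {r : ℕ} (hr : 1 ≤ r) {a : ℤ_[p]} (h : (p : ℤ_[p]) ^ r ∣ a - 1) : IsUnit a := by
  rw [PadicInt.isUnit_iff]
  have hlt : ‖a - 1‖ < 1 := by
    rw [pow_dvd_iff_norm_le_zpow] at h
    refine h.trans_lt ?_
    have hp : (1 : ℝ) < p := by exact_mod_cast (Fact.out : p.Prime).one_lt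
    exact zpow_lt_one_of_neg₀ hp (by omega)
  have key := PadicInt.norm_add_eq_max_of_ne (q := a - 1) (r := 1) (by rw [norm_one]; exact hlt.ne)
  rw [sub_add_cancel, norm_one, max_eq_right hlt.le] at key
  exact key

/-- Substitution by a scalar multiple of a matrix: `f((x,y)(cM)) = c⁴ f((x,y)M)`. [folklore] -/
theorem subst_smul_matrix_eq {R : Type*} [CommRing R] (f : BinaryQuartic R) (c : R) (M : Matrix (Fin 2) (Fin 2) R) :
    f.subst (c • M) = c ^ 4 • f.subst M := by
  ext <;> simp only [subst, Matrix.smul_apply, smul_eq_mul, smul_a, smul_b, smul_c, smul_d, smul_e] <;> ring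

/-- **`K_r · S_r ⊆ W_r`**: for `k ∈ K_r` (`r ≥ 1`) and `s ∈ S_r`, `k • s` is a value of the orbit
chart on the box — at `x = (b/a, c/a, det k/a², λ(1+u) − 1, λ v)`, `λ = a⁴/(det k)²`, for
`k = (a b; c d)`, `s = (1+u)f₁ + vw`. [folklore] -/
theorem exists_mem_chartBox_of_mem {f₁ w : BinaryQuartic ℤ_[p]} {r : ℕ} (hr : 1 ≤ r) {k : G}
    (hk : k ∈ GL2.congruenceSubgroup r) {s : BinaryQuartic ℤ_[p]} (hs : s ∈ slice f₁ w r) :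
    ∃ x ∈ chartBox r, orbitChartForm f₁ w x = k • s := by
  rw [GL2.mem_congruenceSubgroup_iff] at hk
  obtain ⟨u, v, hu, hv, rfl⟩ := hs
  rw [← pow_dvd_iff_norm_le_zpow] at hu hv
  set a : ℤ_[p] := (k : Matrix (Fin 2) (Fin 2) ℤ_[p]) 0 0 with ha_def
  set b : ℤ_[p] := (k : Matrix (Fin 2) (Fin 2) ℤ_[p]) 0 1 with hb_def
  set c : ℤ_[p] := (k : Matrix (Fin 2) (Fin 2) ℤ_[p]) 1 0 with hc_def
  set d : ℤ_[p] := (k : Matrix (Fin 2) (Fin 2) ℤ_[p]) 1 1 with hd_def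
  have ha : (p : ℤ_[p]) ^ r ∣ a - 1 := by simpa [Matrix.one_apply_eq] using hk 0 0
  have hb : (p : ℤ_[p]) ^ r ∣ b := by simpa using hk 0 1
  have hc : (p : ℤ_[p]) ^ r ∣ c := by simpa using hk 1 0
  have hd : (p : ℤ_[p]) ^ r ∣ d - 1 := by simpa [Matrix.one_apply_eq] using hk 1 1
  obtain ⟨ua, hua⟩ := isUnit_of_pow_dvd_sub_one hr ha
  set ai : ℤ_[p] := ((ua⁻¹ : ℤ_[p]ˣ) : ℤ_[p]) with hai
  have haai : a * ai = 1 := by rw [← hua, hai, Units.mul_inv]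
  set D : ℤ_[p] := (k : Matrix (Fin 2) (Fin 2) ℤ_[p]).det with hD_def
  have hD : D = a * d - b * c := by rw [hD_def, Matrix.det_fin_two]
  set Di : ℤ_[p] := (((Matrix.GeneralLinearGroup.det k)⁻¹ : ℤ_[p]ˣ) : ℤ_[p]) with hDi
  have hDDi : D * Di = 1 := det_mul_detInv k
  set lam : ℤ_[p] := Di ^ 2 * a ^ 4 with hlam
  -- the point of the box
  refine ⟨![b * ai, c * ai, D * ai ^ 2, lam * (1 + u) - 1, lam * v], ?_, ?_⟩
  · rw [mem_chartBox_iff]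
    simp only [Matrix.cons_val_zero, Matrix.cons_val_one, Matrix.head_cons, Matrix.cons_val_two, Matrix.tail_cons,
      Matrix.cons_val_three, Matrix.cons_val_four, ← pow_dvd_iff_norm_le_zpow]
    refine ⟨Dvd.dvd.mul_right hb _, Dvd.dvd.mul_right hc _, ?_, ?_, Dvd.dvd.mul_left hv _⟩
    · -- `D ai² − 1 = (D − a²) ai²`
      have h1 : D * ai ^ 2 - 1 = (a * (d - 1) - a * (a - 1) - b * c) * ai ^ 2 := by
        have : a ^ 2 * ai ^ 2 = 1 := by rw [← mul_pow, haai, one_pow]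
        linear_combination this + ai ^ 2 * hD
      rw [h1]
      exact Dvd.dvd.mul_right (dvd_sub (dvd_sub (Dvd.dvd.mul_left hd a) (Dvd.dvd.mul_left ha a)) (Dvd.dvd.mul_left hc b)) _
    · -- `λ(1+u) − 1 = (λ − 1) + λ u`, `λ − 1 = Di² (a² − D)(a² + D)`
      have h1 : lam * (1 + u) - 1 = Di ^ 2 * ((a * (a - 1) - a * (d - 1) + b * c) * (a ^ 2 + D)) + lam * u := by
        have : D ^ 2 * Di ^ 2 = 1 := by rw [← mul_pow, hDDi, one_pow]
        linear_combination this + (-(Di ^ 2 * (a ^ 2 + D))) * hD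
      rw [h1]
      refine dvd_add (Dvd.dvd.mul_left (Dvd.dvd.mul_right ?_ _) _) (Dvd.dvd.mul_left hu _)
      exact dvd_add (dvd_sub (Dvd.dvd.mul_left ha a) (Dvd.dvd.mul_left hd a)) (Dvd.dvd.mul_left hc b)
  · -- the value of the chart is `k • s`
    rw [orbitChartForm_eq, glInt_smul_def]
    simp only [Matrix.cons_val_zero, Matrix.cons_val_one, Matrix.head_cons, Matrix.cons_val_two, Matrix.tail_cons,
      Matrix.cons_val_three, Matrix.cons_val_four]
    have hmat : (k : Matrix (Fin 2) (Fin 2) ℤ_[p]) = a • !![1, b * ai; c * ai, D * ai ^ 2 + b * ai * (c * ai)] := by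
      rw [Matrix.eta_fin_two (k : Matrix (Fin 2) (Fin 2) ℤ_[p]), ← ha_def, ← hb_def, ← hc_def, ← hd_def]
      ext i j
      fin_cases i <;> fin_cases j
      · simp
      · simp only [Matrix.smul_apply, Matrix.of_apply, Matrix.cons_val', Matrix.cons_val_zero, Matrix.cons_val_one,
          Matrix.empty_val', Matrix.cons_val_fin_one, smul_eq_mul, Fin.zero_eta, Fin.mk_one]
        linear_combination (-b) * haai
      · simp only [Matrix.smul_apply, Matrix.of_apply, Matrix.cons_val', Matrix.cons_val_zero, Matrix.cons_val_one,
          Matrix.empty_val', Matrix.cons_val_fin_one, smul_eq_mul, Fin.zero_eta, Fin.mk_one]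
        linear_combination (-c) * haai
      · simp only [Matrix.smul_apply, Matrix.of_apply, Matrix.cons_val', Matrix.cons_val_one,
          Matrix.empty_val', Matrix.cons_val_fin_one, smul_eq_mul, Fin.mk_one]
        linear_combination (-d * (a * ai + 1)) * haai + (-(a * ai ^ 2)) * hD
    rw [hmat, subst_smul_matrix_eq, smul_smul, ← hDi]
    have hform : (1 + (lam * (1 + u) - 1)) • f₁ + (lam * v) • w = lam • ((1 + u) • f₁ + v • w) := by
      rw [smul_add, smul_smul, smul_smul]; congr 1; ring_nf
    rw [hform, smul_subst]

/-- **`W_r ⊆ K_r · S_r`**: every value of the orbit chart on the box (`r ≥ 1`) is `k • s'` with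
`k = M(x) ∈ K_r` and `s' = x₂² · ((1+x₃)f₁ + x₄w) ∈ S_r`. [folklore] -/
theorem exists_mem_slice_of_mem_chartBox {f₁ w : BinaryQuartic ℤ_[p]} {r : ℕ} (hr : 1 ≤ r)
    {x : Fin 5 → ℤ_[p]} (hx : x ∈ chartBox r) :
    ∃ k ∈ GL2.congruenceSubgroup (p := p) r, ∃ s' ∈ slice f₁ w r, orbitChartForm f₁ w x = k • s' := by
  have hx' := hx
  rw [mem_chartBox_iff] at hx'
  obtain ⟨h0, h1, h2, h3, h4⟩ := hx'
  rw [← pow_dvd_iff_norm_le_zpow] at h0 h1 h2 h3 h4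
  set M : Matrix (Fin 2) (Fin 2) ℤ_[p] := !![1, x 0; x 1, x 2 + x 0 * x 1] with hM
  have hdetM : M.det = x 2 := by rw [hM, Matrix.det_fin_two_of]; ring
  have hunit : IsUnit M.det := by rw [hdetM]; exact isUnit_of_pow_dvd_sub_one hr h2
  set k : G := Matrix.GeneralLinearGroup.mk'' M hunit with hk
  have hkmat : (k : Matrix (Fin 2) (Fin 2) ℤ_[p]) = M := rfl
  have hM00 : M 0 0 = 1 := by simp [hM]
  have hM01 : M 0 1 = x 0 := by simp [hM]
  have hM10 : M 1 0 = x 1 := by simp [hM]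
  have hM11 : M 1 1 = x 2 + x 0 * x 1 := by simp [hM]
  have hkK : k ∈ GL2.congruenceSubgroup r := by
    rw [GL2.mem_congruenceSubgroup_iff, hkmat]
    intro i j
    fin_cases i <;> fin_cases j
    · show (p : ℤ_[p]) ^ r ∣ M 0 0 - (1 : Matrix (Fin 2) (Fin 2) ℤ_[p]) 0 0
      rw [hM00, Matrix.one_apply_eq, sub_self]; exact dvd_zero _
    · show (p : ℤ_[p]) ^ r ∣ M 0 1 - (1 : Matrix (Fin 2) (Fin 2) ℤ_[p]) 0 1
      rw [hM01, Matrix.one_apply_ne (by decide), sub_zero]; exact h0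
    · show (p : ℤ_[p]) ^ r ∣ M 1 0 - (1 : Matrix (Fin 2) (Fin 2) ℤ_[p]) 1 0
      rw [hM10, Matrix.one_apply_ne (by decide), sub_zero]; exact h1
    · show (p : ℤ_[p]) ^ r ∣ M 1 1 - (1 : Matrix (Fin 2) (Fin 2) ℤ_[p]) 1 1
      rw [hM11, Matrix.one_apply_eq]
      have : x 2 + x 0 * x 1 - 1 = (x 2 - 1) + x 0 * x 1 := by ring
      rw [this]; exact dvd_add h2 (Dvd.dvd.mul_right h0 _)
  set Di : ℤ_[p] := (((Matrix.GeneralLinearGroup.det k)⁻¹ : ℤ_[p]ˣ) : ℤ_[p]) with hDi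
  have hDDi : x 2 * Di = 1 := by rw [← hdetM, ← hkmat]; exact det_mul_detInv k
  refine ⟨k, hkK, (x 2 ^ 2 * (1 + x 3)) • f₁ + (x 2 ^ 2 * x 4) • w, ⟨x 2 ^ 2 * (1 + x 3) - 1, x 2 ^ 2 * x 4, ?_, ?_, ?_⟩, ?_⟩
  · rw [← pow_dvd_iff_norm_le_zpow]
    have : x 2 ^ 2 * (1 + x 3) - 1 = (x 2 - 1) * (x 2 + 1) + x 2 ^ 2 * x 3 := by ring
    rw [this]; exact dvd_add (Dvd.dvd.mul_right h2 _) (Dvd.dvd.mul_left h3 _)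
  · rw [← pow_dvd_iff_norm_le_zpow]; exact Dvd.dvd.mul_left h4 _
  · congr 1; ring_nf
  · rw [orbitChartForm_eq, glInt_smul_def, hkmat, ← hDi]
    have hform : (x 2 ^ 2 * (1 + x 3)) • f₁ + (x 2 ^ 2 * x 4) • w = (x 2 ^ 2) • ((1 + x 3) • f₁ + x 4 • w) := by
      rw [smul_add, smul_smul, smul_smul]
    rw [hform, smul_subst, smul_smul]
    have : Di ^ 2 * x 2 ^ 2 = 1 := by rw [← mul_pow, mul_comm, hDDi, one_pow]
    rw [this, one_smul]

/-- **`W_r = K_r · S_r`** (`r ≥ 1`). [folklore] -/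
theorem chartImage_eq (f₁ w : BinaryQuartic ℤ_[p]) {r : ℕ} (hr : 1 ≤ r) :
    chartImage f₁ w r = {f | ∃ k ∈ GL2.congruenceSubgroup (p := p) r, ∃ s ∈ slice f₁ w r, f = k • s} := by
  ext f
  constructor
  · rintro ⟨x, hx, rfl⟩
    obtain ⟨k, hk, s', hs', h⟩ := exists_mem_slice_of_mem_chartBox (f₁ := f₁) (w := w) hr hx
    exact ⟨k, hk, s', hs', h⟩
  · rintro ⟨k, hk, s, hs, rfl⟩
    obtain ⟨x, hx, h⟩ := exists_mem_chartBox_of_mem (f₁ := f₁) (w := w) hr hk hs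
    exact ⟨x, hx, h⟩

/-- `W_r` is stable under `K_r`. [folklore] -/
theorem smul_mem_chartImage {f₁ w : BinaryQuartic ℤ_[p]} {r : ℕ} (hr : 1 ≤ r) {k : G}
    (hk : k ∈ GL2.congruenceSubgroup r) {f : BinaryQuartic ℤ_[p]} (hf : f ∈ chartImage f₁ w r) :
    k • f ∈ chartImage f₁ w r := by
  rw [chartImage_eq f₁ w hr] at hf ⊢
  obtain ⟨k', hk', s, hs, rfl⟩ := hf
  exact ⟨k * k', (GL2.congruenceSubgroup r).mul_mem hk hk', s, hs, (mul_smul _ _ _).symm⟩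

/-- `W_r` is stable under the scalars (which act trivially). [folklore] -/
theorem smul_mem_chartImage_of_mem_scalarSubgroup {f₁ w : BinaryQuartic ℤ_[p]} {r : ℕ} {z : G}
    (hz : z ∈ GL2.scalarSubgroup) {f : BinaryQuartic ℤ_[p]} (hf : f ∈ chartImage f₁ w r) :
    z • f ∈ chartImage f₁ w r := by
  obtain ⟨c, rfl⟩ := hz
  rwa [scalarGL_smul]

/-- The slice lies in `W_r`. [folklore] -/
theorem slice_subset_chartImage (f₁ w : BinaryQuartic ℤ_[p]) {r : ℕ} (hr : 1 ≤ r) :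
    slice f₁ w r ⊆ chartImage f₁ w r := by
  intro s hs
  rw [chartImage_eq f₁ w hr]
  exact ⟨1, (GL2.congruenceSubgroup r).one_mem, s, hs, (one_smul _ _).symm⟩

/-- `W_r ⊆ U_r`. [folklore] -/
theorem chartImage_subset_tube (f₁ w : BinaryQuartic ℤ_[p]) {r : ℕ} (hr : 1 ≤ r) :
    chartImage f₁ w r ⊆ tube f₁ w r := by
  intro f hf
  rw [chartImage_eq f₁ w hr] at hf
  obtain ⟨k, -, s, hs, rfl⟩ := hf
  exact ⟨k, s, hs, rfl⟩

/-- **For `s ∈ S_r`: `{h : h • s ∈ W_r} = K_r · Stab(s)`** (as sets; `r ≥ 1`, `p⁻ʳ < |m|_p`).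
[folklore] -/
theorem setOf_smul_mem_chartImage (f₁ w : BinaryQuartic ℤ_[p]) {r : ℕ} (hr : 1 ≤ r)
    (hm : (p : ℝ) ^ (-(r : ℤ)) < ‖f₁.sliceJac w‖) {s : BinaryQuartic ℤ_[p]} (hs : s ∈ slice f₁ w r) :
    {h : G | h • s ∈ chartImage f₁ w r} =
      (GL2.congruenceSubgroup (p := p) r : Set G) * (stabilizer G s : Set G) := by
  ext h
  simp only [mem_setOf_eq, Set.mem_mul, SetLike.mem_coe]
  constructor
  · intro hh
    rw [chartImage_eq f₁ w hr] at hh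
    obtain ⟨k, hk, s', hs', heq⟩ := hh
    have hinv : invPair s = invPair s' := by
      rw [← invPair_glInt_smul h s, heq, invPair_glInt_smul]
    have hss' : s = s' := invPair_injOn_slice f₁ w hm hs hs' hinv
    subst hss'
    refine ⟨k, hk, k⁻¹ * h, ?_, by group⟩
    rw [mem_stabilizer_iff, mul_smul, heq, inv_smul_smul]
  · rintro ⟨k, hk, σ, hσ, rfl⟩
    rw [mul_smul, mem_stabilizer_iff.mp hσ]
    exact smul_mem_chartImage hr hk (slice_subset_chartImage f₁ w hr hs)

end BinaryQuartic

end Literature.NumberTheory.EllipticCurves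

end
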